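import Literature.Analysis.FluidPDE.SobolevWholeSpace
import HarnessLib

/-!
# The Gagliardo–Nirenberg–Sobolev inequality on concentric balls of `(EuclideanSpace ℝ (Fin 3))` (interior form)

Analysis/FluidPDE support file (theorems only) for the decomposition of the named fact
`Literature.Analysis.FluidPDE.tsai1998_lemma32` (Tsai 1998, Lemma 3.2), whose bootstrap (§3.2,
p. 38: "using the Sobolev imbedding theorem, we get `‖∇U‖_{3,B_{1/2}} + ‖P‖_{3,B_{1/2}} = o(|y₀|^{3/2})`
…", "`‖U‖_{6,B₁} ≤ C‖∇U‖_{2,B₁} + C‖U‖_{q,B₁}`") uses Sobolev's imbedding `W^{1,p}(B) ⊂ L^{p*}(B)`,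
`p* = 3p/(3 − p)`, on balls. We prove the **interior** version, which is all the bootstrap needs
(the radius may shrink at each step): for `u ∈ C¹((EuclideanSpace ℝ (Fin 3)); F)` (finite-dimensional `F`), `1 ≤ p < 3`,
`1/p* = 1/p − 1/3`, every centre `x₀` and radius `s > 0`,

  `‖u‖_{L^{p*}(B(x₀,s))} ≤ K_p (‖Du‖_{L^p(B(x₀,3s))} + (C/s) ‖u‖_{L^p(B(x₀,3s))})`

(`eLpNorm_ball_le_eLpNorm_fderiv_add`), with Mathlib's whole-space constant
`K_p = SNormLESNormFDerivOfEqConst F volume p` and a universal `C` (the gradient bound of the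
tree's smooth cutoff `FluidPDE.cutoff`, `WholeSpaceIBP`). Proof: apply Mathlib's
`MeasureTheory.eLpNorm_le_eLpNorm_fderiv_of_eq` (GNS for `C¹_c`) to the truncation
`χ_s(· − x₀) u`, which agrees with `u` on `B(x₀, s)`, is supported in `B̄(x₀, 2s) ⊆ B(x₀, 3s)`, and
has `‖D(χu)‖ ≤ ‖Du‖ + (C/s)‖u‖` (the tree's `SobolevWholeSpace.norm_fderiv_cutoff_smul_le`,
translated). Everything is proved; no definitions, no named facts.

## References

* T.-P. Tsai, *On Leray's self-similar solutions of the Navier–Stokes equations satisfying local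
  energy estimates*, Arch. Rational Mech. Anal. 143 (1998), §3.1–§3.2 (pp. 37–38) [Tsai1998].
* L. C. Evans, *Partial differential equations*, 2nd ed. (2010), §5.6.1, Thm 1–2 (GNS and its
  localisation by cutoffs) [Evans2010].
-/

noncomputable section

open MeasureTheory Set Function Filter Topology Metric Module
open scoped ENNReal NNReal ContDiff

namespace Literature.Analysis.FluidPDE

section GNSBalls

variable {F : Type*} [NormedAddCommGroup F] [NormedSpace ℝ F]

/-- Derivative of a translated truncation: `‖D(χ_s(· − x₀) u)(x)‖ ≤ ‖Du(x)‖ + (C/s)‖u(x)‖` when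
`‖Dχ_s‖ ≤ C/s` (Leibniz rule, `|χ| ≤ 1`). [folklore] -/
theorem norm_fderiv_cutoff_sub_smul_le {u : (EuclideanSpace ℝ (Fin 3)) → F} (hu : ContDiff ℝ 1 u) {C s : ℝ}
    (hC : ∀ x : (EuclideanSpace ℝ (Fin 3)), ‖fderiv ℝ (cutoff s) x‖ ≤ C / s) (x₀ x : (EuclideanSpace ℝ (Fin 3))) :
    ‖fderiv ℝ (fun y : (EuclideanSpace ℝ (Fin 3)) => cutoff s (y - x₀) • u y) x‖ ≤ ‖fderiv ℝ u x‖ + C / s * ‖u x‖ := by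
  have hχ : DifferentiableAt ℝ (fun y : (EuclideanSpace ℝ (Fin 3)) => cutoff s (y - x₀)) x :=
    (((contDiff_cutoff (n := 1) s).comp (contDiff_id.sub contDiff_const)).differentiable
      one_ne_zero) x
  have hux : DifferentiableAt ℝ u x := (hu.differentiable one_ne_zero) x
  have hDχ : fderiv ℝ (fun y : (EuclideanSpace ℝ (Fin 3)) => cutoff s (y - x₀)) x = fderiv ℝ (cutoff s) (x - x₀) :=
    fderiv_comp_sub x₀
  rw [fderiv_fun_smul hχ hux, hDχ]
  calc ‖cutoff s (x - x₀) • fderiv ℝ u x + (fderiv ℝ (cutoff s) (x - x₀)).smulRight (u x)‖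
      ≤ ‖cutoff s (x - x₀) • fderiv ℝ u x‖ + ‖(fderiv ℝ (cutoff s) (x - x₀)).smulRight (u x)‖ :=
        norm_add_le _ _
    _ ≤ ‖fderiv ℝ u x‖ + C / s * ‖u x‖ := by
        gcongr
        · rw [norm_smul, Real.norm_eq_abs]
          exact mul_le_of_le_one_left (norm_nonneg _) (abs_cutoff_le_one s _)
        · rw [ContinuousLinearMap.norm_smulRight_apply]
          exact mul_le_mul_of_nonneg_right (hC _) (norm_nonneg _)

variable [FiniteDimensional ℝ F]

/-- **GNS on concentric balls (interior Sobolev imbedding `W^{1,p} ⊂ L^{p*}` in `(EuclideanSpace ℝ (Fin 3))`).** There is a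
universal `C ≥ 0` such that for every finite-dimensional `F`, every `u ∈ C¹((EuclideanSpace ℝ (Fin 3)); F)`, exponents
`1 ≤ p` and `p*` with `1/p* = 1/p − 1/3`, centre `x₀` and radius `s > 0`:
`‖u‖_{L^{p*}(B(x₀,s))} ≤ K_p (‖Du‖_{L^p(B(x₀,3s))} + (C/s) ‖u‖_{L^p(B(x₀,3s))})`,
`K_p = SNormLESNormFDerivOfEqConst F volume p` (Mathlib's GNS constant). (Tsai: "By Sobolev
imbedding, we get `‖U‖_{6,B₁} ≤ C‖∇U‖_{2,B₁} + C‖U‖_{q,B₁}`", p. 37.)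
[cite: Tsai1998, proof of Lemma 3.1 (p. 37)] -/
theorem exists_eLpNorm_ball_le_eLpNorm_fderiv_add :
    ∃ C : ℝ, 0 ≤ C ∧ ∀ {u : (EuclideanSpace ℝ (Fin 3)) → F}, ContDiff ℝ 1 u → ∀ {p p' : ℝ≥0}, 1 ≤ p →
      (p' : ℝ)⁻¹ = (p : ℝ)⁻¹ - 3⁻¹ → ∀ (x₀ : (EuclideanSpace ℝ (Fin 3))) {s : ℝ}, 0 < s →
        eLpNorm u p' (volume.restrict (ball x₀ s)) ≤
          (SNormLESNormFDerivOfEqConst F (volume : Measure (EuclideanSpace ℝ (Fin 3))) p : ℝ≥0∞) *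
            (eLpNorm (fun x => fderiv ℝ u x) p (volume.restrict (ball x₀ (3 * s))) +
              ENNReal.ofReal (C / s) * eLpNorm u p (volume.restrict (ball x₀ (3 * s)))) := by
  obtain ⟨C, hC0, hC⟩ := exists_norm_fderiv_cutoff_le (E := (EuclideanSpace ℝ (Fin 3)))
  refine ⟨C, hC0, ?_⟩
  intro u hu p p' hp hp' x₀ s hs
  have hp1 : (1 : ℝ≥0∞) ≤ (p : ℝ≥0∞) := by exact_mod_cast hp
  -- the truncation
  set v : (EuclideanSpace ℝ (Fin 3)) → F := fun y => cutoff s (y - x₀) • u y with hv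
  have hv1 : ContDiff ℝ 1 v :=
    ((contDiff_cutoff (n := 1) s).comp (contDiff_id.sub contDiff_const)).smul hu
  have hvsupp : tsupport v ⊆ closedBall x₀ (2 * s) := by
    refine closure_minimal (fun y hy => ?_) isClosed_closedBall
    rw [mem_closedBall, dist_eq_norm]
    by_contra hgt
    refine hy ?_
    show cutoff s (y - x₀) • u y = 0
    rw [cutoff_eq_zero hs (not_le.1 hgt).le, zero_smul]
  have hvc : HasCompactSupport v :=
    (isCompact_closedBall x₀ (2 * s)).of_isClosed_subset isClosed_closure hvsupp
  -- (i) `u = v` on `B(x₀, s)`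
  have h1 : eLpNorm u p' (volume.restrict (ball x₀ s)) = eLpNorm v p' (volume.restrict (ball x₀ s)) := by
    refine eLpNorm_congr_ae ?_
    rw [EventuallyEq, ae_restrict_iff' measurableSet_ball]
    refine Eventually.of_forall fun y hy => ?_
    show u y = cutoff s (y - x₀) • u y
    rw [cutoff_eq_one hs (by rw [mem_ball, dist_eq_norm] at hy; exact hy.le), one_smul]
  -- (ii) GNS on the whole space
  have hn : 0 < finrank ℝ (EuclideanSpace ℝ (Fin 3)) := by rw [finrank_euclideanSpace_fin]; norm_num
  have hp'' : (p' : ℝ)⁻¹ = (p : ℝ)⁻¹ - (finrank ℝ (EuclideanSpace ℝ (Fin 3)) : ℝ)⁻¹ := by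
    rw [hp', finrank_euclideanSpace_fin]; norm_num
  have h2 : eLpNorm v p' volume ≤
      (SNormLESNormFDerivOfEqConst F (volume : Measure (EuclideanSpace ℝ (Fin 3))) p : ℝ≥0∞) * eLpNorm (fderiv ℝ v) p volume :=
    eLpNorm_le_eLpNorm_fderiv_of_eq volume hv1 hvc hp hn hp''
  -- (iii) the derivative lives on `B̄(x₀, 2s) ⊆ B(x₀, 3s)`
  have h3 : eLpNorm (fderiv ℝ v) p volume ≤ eLpNorm (fderiv ℝ v) p (volume.restrict (ball x₀ (3 * s))) := by
    have e1 : eLpNorm (fderiv ℝ v) p volume =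
        eLpNorm ((closedBall x₀ (2 * s)).indicator (fderiv ℝ v)) p volume := by
      refine eLpNorm_congr_ae (Eventually.of_forall fun y => ?_)
      by_cases hy : y ∈ closedBall x₀ (2 * s)
      · exact (indicator_of_mem hy _).symm
      · rw [indicator_of_notMem hy]
        exact fderiv_of_notMem_tsupport ℝ fun h => hy (hvsupp h)
    have e2 : eLpNorm ((closedBall x₀ (2 * s)).indicator (fderiv ℝ v)) p volume =
        eLpNorm (fderiv ℝ v) p ((volume : Measure (EuclideanSpace ℝ (Fin 3))).restrict (closedBall x₀ (2 * s))) :=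
      eLpNorm_indicator_eq_eLpNorm_restrict (f := fderiv ℝ v) measurableSet_closedBall
    have hsub : closedBall x₀ (2 * s) ⊆ ball x₀ (3 * s) := closedBall_subset_ball (by linarith)
    have hmono : (volume : Measure (EuclideanSpace ℝ (Fin 3))).restrict (closedBall x₀ (2 * s)) ≤ volume.restrict (ball x₀ (3 * s)) :=
      Measure.restrict_mono hsub le_rfl
    rw [e1, e2]
    exact eLpNorm_mono_measure _ hmono
  -- (iv) Leibniz bound on `B(x₀, 3s)`
  set μ := (volume : Measure (EuclideanSpace ℝ (Fin 3))).restrict (ball x₀ (3 * s)) with hμ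
  have h4 : eLpNorm (fderiv ℝ v) p μ ≤
      eLpNorm (fun x => fderiv ℝ u x) p μ + ENNReal.ofReal (C / s) * eLpNorm u p μ := by
    have hmeas₁ : AEStronglyMeasurable (fun x => ‖fderiv ℝ u x‖) μ :=
      (hu.continuous_fderiv one_ne_zero).norm.aestronglyMeasurable
    have hmeas₂ : AEStronglyMeasurable (fun x => C / s * ‖u x‖) μ :=
      (continuous_const.mul hu.continuous.norm).aestronglyMeasurable
    calc eLpNorm (fderiv ℝ v) p μ
        ≤ eLpNorm (fun x => ‖fderiv ℝ u x‖ + C / s * ‖u x‖) p μ :=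
          eLpNorm_mono_real (norm_fderiv_cutoff_sub_smul_le hu (hC s hs) x₀)
      _ ≤ eLpNorm (fun x => ‖fderiv ℝ u x‖) p μ + eLpNorm (fun x => C / s * ‖u x‖) p μ :=
          eLpNorm_add_le hmeas₁ hmeas₂ hp1
      _ = eLpNorm (fun x => fderiv ℝ u x) p μ + ENNReal.ofReal (C / s) * eLpNorm u p μ := by
          rw [eLpNorm_norm]
          congr 1
          have : (fun x => C / s * ‖u x‖) = (C / s) • fun x => ‖u x‖ := rfl
          rw [this, eLpNorm_const_smul, eLpNorm_norm, Real.enorm_eq_ofReal (by positivity)]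
  calc eLpNorm u p' (volume.restrict (ball x₀ s)) = eLpNorm v p' (volume.restrict (ball x₀ s)) := h1
    _ ≤ eLpNorm v p' volume := eLpNorm_mono_measure _ Measure.restrict_le_self
    _ ≤ (SNormLESNormFDerivOfEqConst F (volume : Measure (EuclideanSpace ℝ (Fin 3))) p : ℝ≥0∞) * eLpNorm (fderiv ℝ v) p volume := h2
    _ ≤ (SNormLESNormFDerivOfEqConst F (volume : Measure (EuclideanSpace ℝ (Fin 3))) p : ℝ≥0∞) * eLpNorm (fderiv ℝ v) p μ := by gcongr
    _ ≤ (SNormLESNormFDerivOfEqConst F (volume : Measure (EuclideanSpace ℝ (Fin 3))) p : ℝ≥0∞) *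
          (eLpNorm (fun x => fderiv ℝ u x) p μ + ENNReal.ofReal (C / s) * eLpNorm u p μ) := by gcongr

end GNSBalls

end Literature.Analysis.FluidPDE

end
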